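import Summits.QuantumFields.BalabanUV.Beta.MultiscaleRegularityOfMeanValue

/-!
# `Summit.QuantumFields.BalabanUV.Beta.MultiscaleRegularityOfMeanValueL2` — engine file 16d: the ℓ² FORM of the owner's assembly —
# file 9b's local-regularity datum `hreg` for `levelOp` from the WEAKER ℓ² MEAN-VALUE BINDER «`z(x₀) ≤ C_MV·√((2r+1)^{−d}·Σ_{box} z²)`
# for nonnegative Δ_{ℤ^d}-subharmonic `z` on the box» (what a De Giorgi ∕ Moser iteration delivers; implied by the L¹ binder of file
# 16c by Cauchy–Schwarz — `l2binder_of_l1binder`), and the sup member (3.42)₁'s SHAPE for `levelOp` modulo that binder alone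

HONEST FRAMING (page 1 of everything in this cell).  Discharging `FlowStep.BetaPertH` would make Bałaban's ultraviolet
stability UNCONDITIONAL — a constructive-QFT result; it is NOT the continuum limit and NOT the Clay problem.  This module
discharges nothing of `BetaPertH`; it is [folklore] finite-dimensional bookkeeping about the MODEL operator, kernel-checked, by the
OWNER of binder row D4 (unit `b2b-balaban-beta-an4`, gen 45).  HONEST DEPENDENCY: continuum YM on T⁴ ⇐ BetaPertH ∧ nine spine
estimates (0/9 proved); BetaPertH ⇐ (D1) ∧ (D4) ∧ CAP+tail; G-an2-4 gates asym, D1 and NE2/3/4.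

THE POINT (interface robustness for the two roads attacking (MV)).  File 16c consumes the L¹ binder at the centre; co-owner
beta-d4-p3's Poisson-kernel road produces that form, but co-owner beta-d4-p2's kernel De Giorgi road («LATTICE-DEGIORGI-MV»:
Faber–Krahn, Caccioppoli, iteration) naturally produces the ℓ² → ℓ^∞ form, which does NOT imply the L¹ form without a further
absorption step.  Since `hreg`'s first term is an ℓ² quantity anyway, the assembly only ever needed the ℓ² binder: THIS FILE
re-runs the assembly from

  (MV₂)  for every centre `x₀`, radius `r` with `2r + 2 ≤ N_μ`, and `z ≥ 0` with `2d·z(x) ≤ Σ_μ (z(x+e_μ) + z(x−e_μ))` on the box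
         `dist(·,x₀) ≤ r`:  `z(x₀) ≤ C_MV·√((2r+1)^{−d}·Σ_{dist(x,x₀) ≤ r} z(x)²)`   (`C_MV ≥ 1` level-free)

with the SAME constants `c₁ = C_MV/√(θ^d) + √|Cp|·(θ+1)²·a_max·Γ²·√(Γ^d)/(2c₀²)`, `c₂ = √|Cp|·(θ+1)²/(2c₀²)` (`Γ = L^A·e^{(log L/R)(4d+1)}`,
`θ = 1/(4dΓ)`), using beta-d4-p3's general reduction `fibreNorm_le_meanValue` with the monotone functional `Φ(z) = C·√(Σ_{box} z²)`
(`mono_l2`) and file 15b's unit supersolution (`fibreNorm_le_l2_box₂`).  `l2binder_of_l1binder` records that (MV) of file 16c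
implies (MV₂) (Cauchy–Schwarz and `#box ≤ (2r+1)^d`), so 16d is the more general consumer; either road closes O.2 item (ii-b) for
the MODEL through it.

WHAT IS CERTIFIED (kernel, 0 sorry, 0 def): `subharmonic_of_wn` (for `c ≡ c₀ ≠ 0`: `W·z ≤ Nz` at `x` ⟹ `2d·z(x) ≤ Σ_μ(z(x+e_μ) +
z(x−e_μ))`), `l2binder_of_l1binder`, **`fibreNorm_le_l2_box₂`**, **`hreg_of_meanValueL2`**, **`real_sup_levelOp_inverse_le_of_meanValueL2`**
(file 9b BY NAME).  LOCATORS (shape only; ABSOLUTE RULE): [Balaban1985BackgroundPropagators] Thm 3.1 (3.42) p. 397, (3.23) p. 394.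
Row D4: NO class change (critical-path width 0; D4 DISCHARGE NO DATE); NOT BetaPertH, NOT continuum, NOT Clay, NOT summit progress.
-/

open scoped BigOperators
open Finset

namespace Summit.QuantumFields.BalabanUV.Beta.MultiscaleRegularityOfMeanValueL2

open Summit.QuantumFields.BalabanUV.Beta.BoxPoincare (Box)
open Summit.QuantumFields.BalabanUV.Beta.MultiscaleCoerciveTorus
open Summit.QuantumFields.BalabanUV.Beta.MultiscaleDistance
open Summit.QuantumFields.BalabanUV.Beta.MultiscaleDecayBudget
open Summit.QuantumFields.BalabanUV.Beta.MultiscaleSupMember (real_sup_levelOp_inverse_le_of_regularity)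
open Summit.QuantumFields.BalabanUV.Beta.MultiscaleBoxDistance (scale_ge_of_sdist_le sdist_le_of_dist_le)
open Summit.QuantumFields.BalabanUV.Beta.TorusBoxSupersolution (exists_unit_supersolution_box sum_src_const sum_tgt_const
  wsum_src_const wsum_tgt_const)
open Summit.QuantumFields.BalabanUV.Beta.SubsolutionMeanValue (fibreNorm_le_meanValue mono_l2)
open Summit.QuantumFields.BalabanUV.Beta.MultiscaleRegularitySource
open Literature.MathematicalPhysics.QuantumFieldTheory.Balaban1983to89
open Literature.MathematicalPhysics.QuantumFieldTheory.Balaban1983to89.B9Thm37Glue (covD covDT)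
open Literature.MathematicalPhysics.QuantumFieldTheory.Balaban1983to89.B9Thm37GluePU (bsrc btgt)
open Literature.MathematicalPhysics.QuantumFieldTheory.Balaban1983to89.B9Thm37GlueTorusCov (tblk)
open Literature.MathematicalPhysics.QuantumFieldTheory.Balaban1983to89.B9Thm37GlueTorusCovLevels (levelOp levelSum)
open B5TorusCover (UT Ctr ctrU)
open B5Leibniz121 (up dn)

noncomputable section

variable {d : ℕ} {N : Fin d → ℕ} [∀ i, NeZero (N i)]

/-! ## §1 Binder bookkeeping on the torus with a constant bond weight -/

/-- For a constant bond weight `c ≡ c₀ ≠ 0`, `W(x)·z(x) ≤ (Nz)(x)` at a torus site reads `2d·z(x) ≤ Σ_μ (z(x+e_μ) + z(x−e_μ))`.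
[folklore] -/
theorem subharmonic_of_wn [NeZero d] {c : UT N × Fin d → ℝ} {c₀ : ℝ} (hcc : ∀ b, c b = c₀) (hc₀ : c₀ ≠ 0) {z : UT N → ℝ}
    {x : UT N}
    (h : ((∑ b ∈ univ.filter (fun b : UT N × Fin d => btgt b = x), c b ^ 2) +
            ∑ b ∈ univ.filter (fun b : UT N × Fin d => bsrc b = x), c b ^ 2) * z x ≤
          ((∑ b ∈ univ.filter (fun b : UT N × Fin d => btgt b = x), c b ^ 2 * z (bsrc b)) +
            ∑ b ∈ univ.filter (fun b : UT N × Fin d => bsrc b = x), c b ^ 2 * z (btgt b))) :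
    2 * d * z x ≤ ∑ μ, (z (up x μ) + z (dn x μ)) := by
  rw [sum_tgt_const hcc, sum_src_const hcc, wsum_tgt_const hcc, wsum_src_const hcc] at h
  have hc2 : (0 : ℝ) < c₀ ^ 2 := by positivity
  have h' : c₀ ^ 2 * (2 * d * z x) ≤ c₀ ^ 2 * ∑ μ, (z (up x μ) + z (dn x μ)) := by
    rw [Finset.sum_add_distrib]
    have e1 : c₀ ^ 2 * (2 * (d : ℝ) * z x) = ((d : ℝ) * c₀ ^ 2 + d * c₀ ^ 2) * z x := by ring
    have e2 : c₀ ^ 2 * (∑ μ, z (up x μ) + ∑ μ, z (dn x μ)) = c₀ ^ 2 * ∑ μ, z (dn x μ) + c₀ ^ 2 * ∑ μ, z (up x μ) := by ring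
    rw [e1, e2]; exact h
  exact le_of_mul_le_mul_left h' hc2

/-- **The L¹ binder implies the ℓ² binder** (Cauchy–Schwarz and `#box ≤ (2r+1)^d`): file 16c's hypothesis yields this file's.
[folklore] -/
theorem l2binder_of_l1binder [NeZero d] {CMV : ℝ} (hC0 : 0 ≤ CMV)
    (hMV : ∀ (x₀ : UT N) (r : ℕ), (∀ μ, 2 * r + 2 ≤ N μ) → ∀ z : UT N → ℝ, (∀ y, 0 ≤ z y) →
      (∀ x, dist x x₀ ≤ r → 2 * d * z x ≤ ∑ μ, (z (up x μ) + z (dn x μ))) →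
      z x₀ ≤ CMV / (2 * r + 1 : ℝ) ^ d * ∑ x ∈ univ.filter (fun x : UT N => dist x x₀ ≤ r), z x) :
    ∀ (x₀ : UT N) (r : ℕ), (∀ μ, 2 * r + 2 ≤ N μ) → ∀ z : UT N → ℝ, (∀ y, 0 ≤ z y) →
      (∀ x, dist x x₀ ≤ r → 2 * d * z x ≤ ∑ μ, (z (up x μ) + z (dn x μ))) →
      z x₀ ≤ CMV * Real.sqrt (((2 * r + 1 : ℝ) ^ d)⁻¹ * ∑ x ∈ univ.filter (fun x : UT N => dist x x₀ ≤ r), z x ^ 2) := by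
  intro x₀ r hr z hz hsub
  set Bx := univ.filter (fun x : UT N => dist x x₀ ≤ r) with hBx
  have h1 := hMV x₀ r hr z hz hsub
  have hcard : ((Bx.card : ℕ) : ℝ) ≤ (2 * r + 1 : ℝ) ^ d := card_box_le x₀ r
  have hpos : (0 : ℝ) < (2 * r + 1 : ℝ) ^ d := by positivity
  -- Cauchy–Schwarz: `Σ z ≤ √#Bx · √Σ z²`
  have hcs : ∑ x ∈ Bx, z x ≤ Real.sqrt (Bx.card) * Real.sqrt (∑ x ∈ Bx, z x ^ 2) := by
    have h := Finset.sum_mul_sq_le_sq_mul_sq Bx (fun _ => (1 : ℝ)) z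
    simp only [one_pow, one_mul, Finset.sum_const, nsmul_eq_mul, mul_one] at h
    have h0 : 0 ≤ ∑ x ∈ Bx, z x := Finset.sum_nonneg fun x _ => hz x
    rw [← Real.sqrt_mul (Nat.cast_nonneg _), ← Real.sqrt_sq h0]
    exact Real.sqrt_le_sqrt h
  have hrew : CMV * Real.sqrt (((2 * r + 1 : ℝ) ^ d)⁻¹ * ∑ x ∈ Bx, z x ^ 2) =
      CMV * ((Real.sqrt ((2 * r + 1 : ℝ) ^ d))⁻¹ * Real.sqrt (∑ x ∈ Bx, z x ^ 2)) := by
    rw [Real.sqrt_mul (inv_nonneg.mpr hpos.le), Real.sqrt_inv]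
  rw [hrew]
  set s2 := Real.sqrt ((2 * r + 1 : ℝ) ^ d) with hs2
  have hs : Real.sqrt (Bx.card) ≤ s2 := Real.sqrt_le_sqrt hcard
  have hsq : (2 * r + 1 : ℝ) ^ d = s2 ^ 2 := by rw [hs2, Real.sq_sqrt hpos.le]
  have hs0 : 0 < s2 := Real.sqrt_pos.mpr hpos
  have hS0 : 0 ≤ Real.sqrt (∑ x ∈ Bx, z x ^ 2) := Real.sqrt_nonneg _
  calc z x₀ ≤ CMV / (2 * r + 1 : ℝ) ^ d * ∑ x ∈ Bx, z x := h1
    _ ≤ CMV / (2 * r + 1 : ℝ) ^ d * (s2 * Real.sqrt (∑ x ∈ Bx, z x ^ 2)) :=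
        mul_le_mul_of_nonneg_left (hcs.trans (mul_le_mul_of_nonneg_right hs hS0)) (by positivity)
    _ = CMV * (s2⁻¹ * Real.sqrt (∑ x ∈ Bx, z x ^ 2)) := by
        rw [hsq]; field_simp

/-- **File 15b's END with the ℓ² functional** `Φ(z) = C·√(Σ_{B′} z²)`: unit torus, constant weight `c ≡ c₀ ≠ 0`, ANY column-orthonormal
`Rm`, `2r + 2 ≤ N_μ`; if every `z ≥ 0` with `W·z ≤ Nz` on the box `dist(·,x₀) ≤ r` has `z(x₀) ≤ C·√(Σ_{B′} z²)` (`C ≥ 0`) and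
`√(Σ_i ((D*Df)(x,i))²) ≤ m′` on the box (`m′ ≥ 0`), then `√(Σ_i f(x₀,i)²) ≤ C·√(Σ_{x∈B′}Σ_i f(x,i)²) + m′·(r+1)²/(2c₀²)`
(beta-d4-p3's `fibreNorm_le_meanValue` + `mono_l2` + 15b `exists_unit_supersolution_box`). [folklore] -/
theorem fibreNorm_le_l2_box₂ [NeZero d] {Cp : Type} [Fintype Cp] [DecidableEq Cp] {c : UT N × Fin d → ℝ} {c₀ : ℝ}
    (hc : ∀ b, c b = c₀) (hc₀ : c₀ ≠ 0) (Rm : UT N × Fin d → Cp → Cp → ℝ)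
    (hRm : ∀ b i j, ∑ k, Rm b k i * Rm b k j = if i = j then (1 : ℝ) else 0) (f : UT N × Cp → ℝ)
    (x₀ : UT N) {r : ℕ} (hr : ∀ μ, 2 * r + 2 ≤ N μ) (B' : Finset (UT N)) {C : ℝ} (hC : 0 ≤ C)
    (hMV : ∀ z : UT N → ℝ, (∀ y, 0 ≤ z y) →
      (∀ x ∈ univ.filter (fun x : UT N => dist x x₀ ≤ r),
        ((∑ b ∈ univ.filter (fun b : UT N × Fin d => btgt b = x), c b ^ 2) +
            ∑ b ∈ univ.filter (fun b : UT N × Fin d => bsrc b = x), c b ^ 2) * z x ≤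
          ((∑ b ∈ univ.filter (fun b : UT N × Fin d => btgt b = x), c b ^ 2 * z (bsrc b)) +
            ∑ b ∈ univ.filter (fun b : UT N × Fin d => bsrc b = x), c b ^ 2 * z (btgt b))) →
      z x₀ ≤ C * Real.sqrt (∑ x ∈ B', z x ^ 2))
    {m' : ℝ} (hm' : 0 ≤ m')
    (hsrc : ∀ x ∈ univ.filter (fun x : UT N => dist x x₀ ≤ r),
      Real.sqrt (∑ i, (covDT bsrc btgt c Rm (covD bsrc btgt c Rm f) (x, i)) ^ 2) ≤ m') :
    Real.sqrt (∑ i, f (x₀, i) ^ 2) ≤ C * Real.sqrt (∑ x ∈ B', ∑ i, f (x, i) ^ 2) + m' * (((r : ℝ) + 1) ^ 2 / (2 * c₀ ^ 2)) := by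
  obtain ⟨w₀, h0, hle, hsup⟩ := exists_unit_supersolution_box hc hc₀ x₀ hr
  have h := fibreNorm_le_meanValue bsrc btgt c Rm hRm f (univ.filter (fun x : UT N => dist x x₀ ≤ r)) x₀
    (fun z => C * Real.sqrt (∑ x ∈ B', z x ^ 2)) (fun z z' hz hzz => mono_l2 B' hC z z' hz hzz) hMV w₀ h0 hsup hm' hsrc
  have hsq : ∀ x, Real.sqrt (∑ i, f (x, i) ^ 2) ^ 2 = ∑ i, f (x, i) ^ 2 := fun x =>
    Real.sq_sqrt (Finset.sum_nonneg fun i _ => sq_nonneg _)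
  simp only [hsq] at h
  have h2 := mul_le_mul_of_nonneg_left (hle x₀) hm'
  linarith

/-! ## §2 The analytic setting (as in file 16c) -/

variable [NeZero d] {Cp J K : Type} [Fintype Cp] [DecidableEq Cp] [Nonempty Cp]
  [Fintype J] [Fintype K] [DecidableEq K] (S : J → ℕ) (hS : ∀ l, 1 ≤ S l) (hdivS : ∀ l i, S l ∣ N i) (lvl : K → J)
  (zc : (k : K) → Ctr N (S (lvl k)))
  (hdisj : ∀ k k' v v', cellPt S hS hdivS lvl zc k v = cellPt S hS hdivS lvl zc k' v' → k = k')
  (hcover : ∀ x : UT N, ∃ k, ∃ v : Box d (S (lvl k)), cellPt S hS hdivS lvl zc k v = x)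
  (Rm : UT N × Fin d → Cp → Cp → ℝ) (hRm : ∀ b i j, ∑ k, Rm b k i * Rm b k j = if i = j then (1 : ℝ) else 0)
  (T : J → UT N → Cp → Cp → ℝ) (hT : ∀ l x i i', ∑ k, T l x k i * T l x k i' = if i = i' then (1 : ℝ) else 0)
  (a : J → ℝ) (ha : ∀ j, 0 ≤ a j) (ω : J → UT N → ℝ)
  (hsupp : ∀ l x, ω l (ctrU N (S l) (tblk (hS l) (hdivS l) x)) ≠ 0 → ∃ k v, lvl k = l ∧ cellPt S hS hdivS lvl zc k v = x)
  {amax : ℝ} (hamax : 0 ≤ amax)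
  (hscale : ∀ k, a (lvl k) * ω (lvl k) (ctrU N (S (lvl k)) (zc k)) ^ 2 * (S (lvl k) : ℝ) ^ d ≤ amax / (S (lvl k) : ℝ) ^ 2)
  (c : UT N × Fin d → ℝ) {c₀ : ℝ} (hcc : ∀ b, c b = c₀) (hc₀ : c₀ ≠ 0)
  {L : ℕ} (hL : 1 ≤ L) (e : J → ℕ) (hSe : ∀ l, S l = L ^ e l) {R : ℝ} (hR : 0 < R) {A : ℕ}
  (hadd : ∀ x y : UT N, |(e (lvl (cellOf S hS hdivS lvl zc hcover x)) : ℝ) - e (lvl (cellOf S hS hdivS lvl zc hcover y))| ≤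
    A + sdist bsrc btgt (siteScale S hS hdivS lvl zc hcover) x y / R)

include hdisj hT ha hsupp hamax hscale hL e hSe hR hadd hRm hcc hc₀

/-! ## §3 THE DATUM `hreg` OF FILE 9b FROM THE ℓ² MEAN-VALUE BINDER -/

omit [Fintype K] in
/-- **`hreg` FOR `levelOp` FROM THE ℓ² MEAN-VALUE BINDER.**  MODEL setting of `MultiscaleDecay.hc_levelOp` with a CONSTANT bond
weight `c ≡ c₀ ≠ 0`, graded sides `S_l = L^{e_l}` (`1 ≤ L`, `0 < R`) with the sitewise additive datum, the (P) budget `hscale`;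
`Γ = L^A·e^{(log L/R)(4d+1)}`, `θ = 1/(4dΓ)`.  ASSUME the ℓ² mean-value binder (MV₂) with a constant `C_MV ≥ 1`: for every centre
`x₀`, radius `r` with `2r + 2 ≤ N_μ` for all `μ`, and `z ≥ 0` with `2d·z(x) ≤ Σ_μ (z(x+e_μ) + z(x−e_μ))` whenever `dist(x,x₀) ≤ r`,
`z(x₀) ≤ C_MV·√((2r+1)^{−d}·Σ_{dist(x,x₀) ≤ r} z(x)²)` (a HYPOTHESIS — ABSOLUTE RULE).  THEN file 9b's datum holds with `ρ₀ = 4d + 1`: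
for every field `f`, site `p` and `m′`, if `|(levelOp f)(q)| ≤ m′` for all `q` with `d_n(q, p) ≤ 4d + 1`, then
`|f(p)| ≤ c₁·√(n(p)^{−d}·Σ_{d_n(q,p) ≤ 4d+1} f(q)²) + c₂·n(p)²·m′` with
`c₁ = C_MV/√(θ^d) + √|Cp|·(θ+1)²·a_max·Γ²·√(Γ^d)/(2c₀²)` and `c₂ = √|Cp|·(θ+1)²/(2c₀²)`.
[cite: Balaban1985BackgroundPropagators, Thm 3.1 (3.42) p.397; Balaban1983RegularityDecay, Lemma 2.2 (2.17) p.577] [folklore] -/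
theorem hreg_of_meanValueL2 {Γ θ : ℝ} (hΓ : Γ = (L : ℝ) ^ A * Real.exp (Real.log L / R * (4 * d + 1)))
    (hθ : θ = 1 / (4 * d * Γ)) {CMV : ℝ} (hC1 : 1 ≤ CMV)
    (hMV : ∀ (x₀ : UT N) (r : ℕ), (∀ μ, 2 * r + 2 ≤ N μ) → ∀ z : UT N → ℝ, (∀ y, 0 ≤ z y) →
      (∀ x, dist x x₀ ≤ r → 2 * d * z x ≤ ∑ μ, (z (up x μ) + z (dn x μ))) →
      z x₀ ≤ CMV * Real.sqrt (((2 * r + 1 : ℝ) ^ d)⁻¹ * ∑ x ∈ univ.filter (fun x : UT N => dist x x₀ ≤ r), z x ^ 2)) :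
    ∀ (f : UT N × Cp → ℝ) (p : UT N × Cp) (m' : ℝ),
      (∀ q : UT N × Cp, sdist bsrc btgt (siteScale S hS hdivS lvl zc hcover) q.1 p.1 ≤ 4 * d + 1 →
        |levelOp bsrc btgt c Rm (fun l x => ctrU N (S l) (tblk (hS l) (hdivS l) x))
          (fun l x => ω l (ctrU N (S l) (tblk (hS l) (hdivS l) x))) T a f q| ≤ m') →
      |f p| ≤ (CMV / Real.sqrt (θ ^ d) +
            Real.sqrt (Fintype.card Cp) * (θ + 1) ^ 2 * (amax * Γ ^ 2 * Real.sqrt (Γ ^ d)) / (2 * c₀ ^ 2)) *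
          Real.sqrt (((siteScale S hS hdivS lvl zc hcover p.1 : ℝ) ^ d)⁻¹ *
            ∑ q ∈ univ.filter (fun q : UT N × Cp =>
              sdist bsrc btgt (siteScale S hS hdivS lvl zc hcover) q.1 p.1 ≤ 4 * d + 1), f q ^ 2) +
        Real.sqrt (Fintype.card Cp) * (θ + 1) ^ 2 / (2 * c₀ ^ 2) * (siteScale S hS hdivS lvl zc hcover p.1 : ℝ) ^ 2 * m' := by
  intro f p m' hAf
  obtain ⟨x₀, i₀⟩ := p
  dsimp only at hAf ⊢
  set n := siteScale S hS hdivS lvl zc hcover with hn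
  set Bx := univ.filter (fun x : UT N => dist x x₀ ≤ (⌊(n x₀ : ℝ) * θ⌋₊ : ℕ)) with hBx
  set Bl := univ.filter (fun q : UT N × Cp => sdist bsrc btgt n q.1 x₀ ≤ 4 * d + 1) with hBl
  set X := Real.sqrt ((((n x₀ : ℝ)) ^ d)⁻¹ * ∑ q ∈ Bl, f q ^ 2) with hX
  set Kc := Real.sqrt (Fintype.card Cp) with hKc
  set G := amax * Γ ^ 2 * Real.sqrt (Γ ^ d) with hG
  -- positivity
  have hd1 : (1 : ℝ) ≤ d := by exact_mod_cast Nat.one_le_iff_ne_zero.mpr (NeZero.ne d)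
  have hd0 : (0 : ℝ) < d := by linarith
  have hL1 : (1 : ℝ) ≤ L := by exact_mod_cast hL
  have hΓ1 : 1 ≤ Γ := by
    rw [hΓ]
    have h1 : (1 : ℝ) ≤ (L : ℝ) ^ A := one_le_pow₀ hL1
    have h2 : (1 : ℝ) ≤ Real.exp (Real.log L / R * (4 * d + 1)) :=
      Real.one_le_exp (mul_nonneg (div_nonneg (Real.log_nonneg hL1) hR.le) (by positivity))
    nlinarith
  have hΓ0 : 0 < Γ := by linarith
  have hθ0 : 0 < θ := by rw [hθ]; positivity
  have hθ4 : θ ≤ 1 / 4 := by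
    rw [hθ, div_le_div_iff₀ (by positivity) (by norm_num)]
    nlinarith
  have hdθΓ : (d : ℝ) * θ * Γ = 1 / 4 := by rw [hθ]; field_simp
  have hn0 : (0 : ℝ) < n x₀ := by exact_mod_cast one_le_siteScale S hS hdivS lvl zc hcover x₀
  have hn1 : (1 : ℝ) ≤ n x₀ := by exact_mod_cast one_le_siteScale S hS hdivS lvl zc hcover x₀
  have hKc0 : 0 ≤ Kc := Real.sqrt_nonneg _
  have hG0 : 0 ≤ G := by rw [hG]; positivity
  have hc2 : (0 : ℝ) < c₀ ^ 2 := by positivity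
  have hX0 : 0 ≤ X := Real.sqrt_nonneg _
  have hCMV0 : 0 < CMV := by linarith
  -- `m′ ≥ 0` (the centre is in its own ball)
  have hself : sdist bsrc btgt n x₀ x₀ ≤ 4 * d + 1 := by rw [sdist_self]; positivity
  have hm' : 0 ≤ m' := (abs_nonneg _).trans (hAf (x₀, i₀) hself)
  -- `|f p| ≤ ‖f(x₀,·)‖ ≤ ‖f‖_{ℓ²(ball)} = √(n₀^d)·X`
  have hfib : |f (x₀, i₀)| ≤ Real.sqrt (∑ j, f (x₀, j) ^ 2) := abs_le_fibreNorm f x₀ i₀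
  have hball_eq : Real.sqrt (∑ q ∈ Bl, f q ^ 2) = Real.sqrt ((n x₀ : ℝ) ^ d) * X := by
    rw [hX, ← Real.sqrt_mul (by positivity), ← mul_assoc, mul_inv_cancel₀ (by positivity), one_mul]
  have hfib_ball : Real.sqrt (∑ j, f (x₀, j) ^ 2) ≤ Real.sqrt (∑ q ∈ Bl, f q ^ 2) := by
    refine Real.sqrt_le_sqrt ?_
    have h := sum_box_fibre_le_sum f {x₀} Bl (fun x hx i => by
      rw [Finset.mem_singleton] at hx
      rw [hx, hBl, mem_filter]
      exact ⟨mem_univ _, hself⟩)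
    simpa using h
  -- the target's two coefficients are nonnegative
  have hc1a : 0 ≤ CMV / Real.sqrt (θ ^ d) := by positivity
  have hc1b : 0 ≤ Kc * (θ + 1) ^ 2 * G / (2 * c₀ ^ 2) := by positivity
  have hc2n : 0 ≤ Kc * (θ + 1) ^ 2 / (2 * c₀ ^ 2) * (n x₀ : ℝ) ^ 2 * m' := by positivity
  by_cases hsmall : (n x₀ : ℝ) * θ < 1
  · -- SMALL SCALES: the trivial bound `|f| ≤ ‖f‖_{ℓ²(ball)} = √(n₀^d)·X ≤ X/√(θ^d)`
    have h1 : Real.sqrt ((n x₀ : ℝ) ^ d) ≤ 1 / Real.sqrt (θ ^ d) := by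
      rw [le_div_iff₀ (by positivity), ← Real.sqrt_mul (by positivity), ← mul_pow]
      calc Real.sqrt (((n x₀ : ℝ) * θ) ^ d) ≤ Real.sqrt 1 :=
            Real.sqrt_le_sqrt (pow_le_one₀ (by positivity) hsmall.le)
        _ = 1 := Real.sqrt_one
    have h2 : 1 / Real.sqrt (θ ^ d) ≤ CMV / Real.sqrt (θ ^ d) := by gcongr
    calc |f (x₀, i₀)| ≤ Real.sqrt ((n x₀ : ℝ) ^ d) * X := by rw [← hball_eq]; exact hfib.trans hfib_ball
      _ ≤ CMV / Real.sqrt (θ ^ d) * X := mul_le_mul_of_nonneg_right (h1.trans h2) hX0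
      _ ≤ (CMV / Real.sqrt (θ ^ d) + Kc * (θ + 1) ^ 2 * G / (2 * c₀ ^ 2)) * X +
            Kc * (θ + 1) ^ 2 / (2 * c₀ ^ 2) * (n x₀ : ℝ) ^ 2 * m' := by nlinarith
  · -- LARGE SCALES: the box of radius `r = ⌊n₀θ⌋ ≥ 1`
    push Not at hsmall
    set r : ℕ := ⌊(n x₀ : ℝ) * θ⌋₊ with hr
    have hr_le : (r : ℝ) ≤ n x₀ * θ := Nat.floor_le (by positivity)
    have hr_lt : (n x₀ : ℝ) * θ < r + 1 := Nat.lt_floor_add_one _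
    have hr1 : 1 ≤ r := Nat.le_floor (by exact_mod_cast hsmall)
    -- torus room `2r + 2 ≤ N_μ` (from `4r ≤ n₀ ≤ N_μ`)
    have hroom : ∀ μ, 2 * r + 2 ≤ N μ := by
      intro μ
      have h4 : (4 * r : ℝ) ≤ n x₀ := by
        have : (n x₀ : ℝ) * θ ≤ n x₀ * (1 / 4) := mul_le_mul_of_nonneg_left hθ4 hn0.le
        linarith
      have h4' : 4 * r ≤ n x₀ := by exact_mod_cast h4
      have hnN : n x₀ ≤ N μ := Nat.le_of_dvd (Nat.pos_of_ne_zero (NeZero.ne _)) (hdivS _ μ)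
      omega
    -- the box lies in the `d_n`-ball of radius `1/4`
    have hgr : ∀ y, n y = L ^ (e (lvl (cellOf S hS hdivS lvl zc hcover y))) := fun y => by rw [hn, siteScale, hSe]
    have hboxrad : ((d * r : ℕ) : ℝ) * ((L : ℝ) ^ A * Real.exp (Real.log L / R * (4 * d + 1))) / n x₀ ≤ 1 / 4 := by
      rw [← hΓ, div_le_iff₀ hn0]
      push_cast
      calc (d : ℝ) * r * Γ ≤ d * (n x₀ * θ) * Γ := by gcongr
        _ = (d * θ * Γ) * n x₀ := by ring
        _ = 1 / 4 * n x₀ := by rw [hdθΓ]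
    have hquarter : (1 : ℝ) / 4 ≤ 4 * d + 1 := by linarith
    have hbox : ∀ x, dist x x₀ ≤ r → sdist bsrc btgt n x x₀ ≤ 1 / 4 := fun x hx =>
      (sdist_le_of_dist_le n (one_le_siteScale S hS hdivS lvl zc hcover) hL
        (fun y => e (lvl (cellOf S hS hdivS lvl zc hcover y))) hgr hR x₀ (fun y => hadd y x₀) r
        (hboxrad.trans hquarter) hx).trans hboxrad
    -- the Kato source on the box
    have hs44 : (1 : ℝ) / 4 + 4 * d ≤ 4 * d + 1 := by linarith
    set msrc := Kc * (m' + G * ((n x₀ : ℝ) ^ 2)⁻¹ * X) with hmsrc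
    have hmsrc0 : 0 ≤ msrc := by rw [hmsrc]; positivity
    have hsrc : ∀ x ∈ Bx, Real.sqrt (∑ i, (covDT bsrc btgt c Rm (covD bsrc btgt c Rm f) (x, i)) ^ 2) ≤ msrc := by
      intro x hx
      have h := source_le_on_box S hS hdivS lvl zc hdisj hcover Rm T hT a ha ω hsupp hamax hscale c hL e hSe hR hadd f hs44
        (hbox x (mem_filter.mp hx).2) hAf
      rw [← hΓ] at h
      refine h.trans (le_of_eq ?_)
      rw [hmsrc, hKc, hG, hX]
    -- the binder at `(box, x₀)` in the `W·z ≤ Nz` currency (constant `CMV·√((2r+1)^{-d})` over `B′ = box`), and the ℓ² END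
    have h2r1 : (0 : ℝ) < (2 * r + 1 : ℝ) ^ d := by positivity
    set s2 := Real.sqrt ((2 * r + 1 : ℝ) ^ d) with hs2
    have hs0 : 0 < s2 := Real.sqrt_pos.mpr h2r1
    have hC : 0 ≤ CMV * s2⁻¹ := by positivity
    have hMV' : ∀ z : UT N → ℝ, (∀ y, 0 ≤ z y) →
        (∀ x ∈ Bx, ((∑ b ∈ univ.filter (fun b : UT N × Fin d => btgt b = x), c b ^ 2) +
            ∑ b ∈ univ.filter (fun b : UT N × Fin d => bsrc b = x), c b ^ 2) * z x ≤
          ((∑ b ∈ univ.filter (fun b : UT N × Fin d => btgt b = x), c b ^ 2 * z (bsrc b)) +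
            ∑ b ∈ univ.filter (fun b : UT N × Fin d => bsrc b = x), c b ^ 2 * z (btgt b))) →
        z x₀ ≤ CMV * s2⁻¹ * Real.sqrt (∑ x ∈ Bx, z x ^ 2) := by
      intro z hz hsub
      have h := hMV x₀ r hroom z hz (fun x hx => subharmonic_of_wn hcc hc₀ (hsub x (mem_filter.mpr ⟨mem_univ _, hx⟩)))
      rw [Real.sqrt_mul (inv_nonneg.mpr h2r1.le), Real.sqrt_inv, ← hs2, ← mul_assoc] at h
      exact h
    have hEND := fibreNorm_le_l2_box₂ hcc hc₀ Rm hRm f x₀ hroom Bx hC hMV' hmsrc0 hsrc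
    -- FIRST TERM: `CMV·√((2r+1)^{-d}) · ‖f‖_{ℓ²(box)} ≤ CMV/√(θ^d) · X`
    have hsumBx : ∑ x ∈ Bx, ∑ i, f (x, i) ^ 2 ≤ ∑ q ∈ Bl, f q ^ 2 :=
      sum_box_fibre_le_sum f Bx Bl fun x hx i => by
        rw [hBl, mem_filter]
        exact ⟨mem_univ _, (hbox x (mem_filter.mp hx).2).trans hquarter⟩
    have hfirst : CMV * s2⁻¹ * Real.sqrt (∑ x ∈ Bx, ∑ i, f (x, i) ^ 2) ≤ CMV / Real.sqrt (θ ^ d) * X := by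
      have hB : Real.sqrt (∑ x ∈ Bx, ∑ i, f (x, i) ^ 2) ≤ Real.sqrt ((n x₀ : ℝ) ^ d) * X := by
        rw [← hball_eq]; exact Real.sqrt_le_sqrt hsumBx
      have hθd : 0 < Real.sqrt (θ ^ d) := Real.sqrt_pos.mpr (by positivity)
      -- `√(n₀^d)·√(θ^d) ≤ √((2r+1)^d)` since `n₀θ ≤ 2r+1`
      have hkey : Real.sqrt ((n x₀ : ℝ) ^ d) * Real.sqrt (θ ^ d) ≤ s2 := by
        rw [hs2, ← Real.sqrt_mul (by positivity), ← mul_pow]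
        exact Real.sqrt_le_sqrt (pow_le_pow_left₀ (by positivity) (by linarith) d)
      have hratio : Real.sqrt ((n x₀ : ℝ) ^ d) / s2 ≤ 1 / Real.sqrt (θ ^ d) := by
        rw [div_le_div_iff₀ hs0 hθd, one_mul]; exact hkey
      calc CMV * s2⁻¹ * Real.sqrt (∑ x ∈ Bx, ∑ i, f (x, i) ^ 2)
          ≤ CMV * s2⁻¹ * (Real.sqrt ((n x₀ : ℝ) ^ d) * X) := mul_le_mul_of_nonneg_left hB hC
        _ = CMV * X * (Real.sqrt ((n x₀ : ℝ) ^ d) / s2) := by field_simp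
        _ ≤ CMV * X * (1 / Real.sqrt (θ ^ d)) := mul_le_mul_of_nonneg_left hratio (mul_nonneg hCMV0.le hX0)
        _ = CMV / Real.sqrt (θ ^ d) * X := by ring
    -- SECOND TERM: `msrc·(r+1)²/(2c₀²) ≤ Kc(θ+1)²/(2c₀²)·n₀²·m′ + Kc(θ+1)²G/(2c₀²)·X`
    have hr1' : ((r : ℝ) + 1) ^ 2 ≤ ((θ + 1) * n x₀) ^ 2 := by
      refine pow_le_pow_left₀ (by positivity) ?_ 2
      have : (θ + 1) * (n x₀ : ℝ) = n x₀ * θ + n x₀ := by ring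
      rw [this]; linarith
    have hsecond : msrc * (((r : ℝ) + 1) ^ 2 / (2 * c₀ ^ 2)) ≤
        Kc * (θ + 1) ^ 2 / (2 * c₀ ^ 2) * (n x₀ : ℝ) ^ 2 * m' + Kc * (θ + 1) ^ 2 * G / (2 * c₀ ^ 2) * X := by
      calc msrc * (((r : ℝ) + 1) ^ 2 / (2 * c₀ ^ 2)) ≤ msrc * (((θ + 1) * n x₀) ^ 2 / (2 * c₀ ^ 2)) := by gcongr
        _ = Kc * (θ + 1) ^ 2 / (2 * c₀ ^ 2) * (n x₀ : ℝ) ^ 2 * m' + Kc * (θ + 1) ^ 2 * G / (2 * c₀ ^ 2) * X := by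
            rw [hmsrc]; field_simp
    -- assemble
    calc |f (x₀, i₀)| ≤ Real.sqrt (∑ j, f (x₀, j) ^ 2) := hfib
      _ ≤ CMV * s2⁻¹ * Real.sqrt (∑ x ∈ Bx, ∑ i, f (x, i) ^ 2) + msrc * (((r : ℝ) + 1) ^ 2 / (2 * c₀ ^ 2)) := hEND
      _ ≤ CMV / Real.sqrt (θ ^ d) * X +
            (Kc * (θ + 1) ^ 2 / (2 * c₀ ^ 2) * (n x₀ : ℝ) ^ 2 * m' + Kc * (θ + 1) ^ 2 * G / (2 * c₀ ^ 2) * X) :=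
          add_le_add hfirst hsecond
      _ = (CMV / Real.sqrt (θ ^ d) + Kc * (θ + 1) ^ 2 * G / (2 * c₀ ^ 2)) * X +
            Kc * (θ + 1) ^ 2 / (2 * c₀ ^ 2) * (n x₀ : ℝ) ^ 2 * m' := by ring

/-! ## §4 COROLLARY: the sup member (3.42)₁'s SHAPE for `levelOp` modulo (MV₂) alone (file 9b BY NAME) -/

/-- **THE SUP-NORM MEMBER'S SHAPE FOR `levelOp`, SITEWISE, LEVEL-FREE, MODULO THE ℓ² MEAN-VALUE BINDER ALONE.**  File 9b's
`real_sup_levelOp_inverse_le_of_regularity` with its datum `hreg` DISCHARGED by `hreg_of_meanValueL2` (`ρ₀ = 4d + 1`): in the MODEL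
setting of `MultiscaleDecay.hc_levelOp` with a constant bond weight `c ≡ c₀ ≠ 0`, the additive grading, the rate condition
`(1 + d/2)(log L/R) ≤ κ` and (MV₂) with constant `C_MV ≥ 1`, for `u` supported in cell `k′` with `|u| ≤ m` and every `p = (x,i)`:
`|((levelOp)⁻¹u)(p)| ≤ (c₁K₁ + c₂K₂)·n(x)²·e^{−(κ − (1+d/2)log L/R)·d_n(x,t_{k′})}·m` with 9b's `K₁, K₂` at `ρ₀ = 4d+1` and §3's
`c₁, c₂` — constants seeing `d, c₀, a_max, C, κ, L, A, R, C_MV, |Cp|` only.  NOT a discharge of (ii-b): (MV₂) is a hypothesis.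
[cite: Balaban1985BackgroundPropagators, Thm 3.1 (3.42) p.397; Balaban1984PropagatorsII, Prop. 2.2 (2.67) p.234] [folklore] -/
theorem real_sup_levelOp_inverse_le_of_meanValueL2 {cmax : ℝ} (hc : ∀ b, |c b| ≤ cmax) {C : ℝ}
    (hcoer : ∀ f : UT N × Cp → ℝ,
      C * ∑ k, ((S (lvl k) : ℝ) ^ 2)⁻¹ * ∑ v : Box d (S (lvl k)), ∑ i, f (cellPt S hS hdivS lvl zc k v, i) ^ 2 ≤
        ∑ p, f p * levelOp bsrc btgt c Rm (fun l x => ctrU N (S l) (tblk (hS l) (hdivS l) x))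
          (fun l x => ω l (ctrU N (S l) (tblk (hS l) (hdivS l) x))) T a f p)
    {κ : ℝ} (hκ0 : 0 ≤ κ) (hκ1 : κ ≤ 1) (hμ : 0 < C - 2 * d * cmax ^ 2 * κ ^ 2 - amax * (Real.exp (2 * d * κ) - 1))
    (hrate : (1 + d / 2) * (Real.log L / R) ≤ κ)
    {Γ θ : ℝ} (hΓ : Γ = (L : ℝ) ^ A * Real.exp (Real.log L / R * (4 * d + 1))) (hθ : θ = 1 / (4 * d * Γ)) {CMV : ℝ}
    (hC1 : 1 ≤ CMV)
    (hMV : ∀ (x₀ : UT N) (r : ℕ), (∀ μ, 2 * r + 2 ≤ N μ) → ∀ z : UT N → ℝ, (∀ y, 0 ≤ z y) →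
      (∀ x, dist x x₀ ≤ r → 2 * d * z x ≤ ∑ μ, (z (up x μ) + z (dn x μ))) →
      z x₀ ≤ CMV * Real.sqrt (((2 * r + 1 : ℝ) ^ d)⁻¹ * ∑ x ∈ univ.filter (fun x : UT N => dist x x₀ ≤ r), z x ^ 2))
    (k' : K) (u : UT N × Cp → ℝ) (hu : ∀ p, cellOf S hS hdivS lvl zc hcover p.1 ≠ k' → u p = 0)
    {m : ℝ} (hm : 0 ≤ m) (hum : ∀ p, |u p| ≤ m) (p : UT N × Cp) :
    |(Ring.inverse (levelOp bsrc btgt c Rm (fun l x => ctrU N (S l) (tblk (hS l) (hdivS l) x))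
        (fun l x => ω l (ctrU N (S l) (tblk (hS l) (hdivS l) x))) T a)) u p| ≤
      ((CMV / Real.sqrt (θ ^ d) + Real.sqrt (Fintype.card Cp) * (θ + 1) ^ 2 * (amax * Γ ^ 2 * Real.sqrt (Γ ^ d)) / (2 * c₀ ^ 2)) *
          (Real.sqrt (Fintype.card Cp) * Real.exp (κ * ((4 * d + 1) + 2 * d)) *
            ((L : ℝ) ^ A * Real.exp (Real.log L / R * (4 * d + 1))) * (L : ℝ) ^ A * Real.sqrt (((L : ℝ) ^ A) ^ d) /
            (C - 2 * d * cmax ^ 2 * κ ^ 2 - amax * (Real.exp (2 * d * κ) - 1))) +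
          Real.sqrt (Fintype.card Cp) * (θ + 1) ^ 2 / (2 * c₀ ^ 2) *
            Real.exp ((κ - (1 + d / 2) * (Real.log L / R)) * ((4 * d + 1) + 2 * d))) *
        (siteScale S hS hdivS lvl zc hcover p.1 : ℝ) ^ 2 *
        Real.exp (-((κ - (1 + d / 2) * (Real.log L / R)) *
          sdist bsrc btgt (siteScale S hS hdivS lvl zc hcover) p.1 (ctrU N (S (lvl k')) (zc k')))) * m := by
  have hd0 : (0 : ℝ) < d := by exact_mod_cast Nat.pos_of_ne_zero (NeZero.ne d)
  have hL0 : (0 : ℝ) < L := by exact_mod_cast hL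
  have hΓ0 : 0 < Γ := by rw [hΓ]; positivity
  have hθ0 : 0 < θ := by rw [hθ]; positivity
  have hCMV0 : 0 ≤ CMV := by linarith
  have hc₁ : 0 ≤ CMV / Real.sqrt (θ ^ d) +
      Real.sqrt (Fintype.card Cp) * (θ + 1) ^ 2 * (amax * Γ ^ 2 * Real.sqrt (Γ ^ d)) / (2 * c₀ ^ 2) := by positivity
  have hc₂ : 0 ≤ Real.sqrt (Fintype.card Cp) * (θ + 1) ^ 2 / (2 * c₀ ^ 2) := by positivity
  exact real_sup_levelOp_inverse_le_of_regularity S hS hdivS lvl zc hdisj hcover Rm hRm T hT a ha ω hsupp hamax hscale c hc hcoer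
    hκ0 hκ1 hμ hL e hSe hR hadd hrate hc₁ hc₂
    (hreg_of_meanValueL2 S hS hdivS lvl zc hdisj hcover Rm hRm T hT a ha ω hsupp hamax hscale c hcc hc₀ hL e hSe hR hadd hΓ hθ
      hC1 hMV) k' u hu hm hum p

end

end Summit.QuantumFields.BalabanUV.Beta.MultiscaleRegularityOfMeanValueL2
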